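import Summits.Ventures.YMGap.FlowData.KWeightTailOperator
import Literature.Analysis.Matrix.KyFanMaximumPrinciple

/-!
# Venture YMGap, track Y3 FLOW-DATA — TAIL-A at operator level: PADDING THE KEPT FAMILY BY WEIGHT-ZERO MEMBERS COSTS
# NOTHING (the kept Galerkin block restricted to the support of the weights; theorems only)

HONEST FRAMING: venture file of the cell `pub-ymgap` (QuantumFields programme), track Y3, lineage A (seat flow-eng-1).
Finite-dimensional real linear algebra about the kept Galerkin block `G_ij = √q_i √q_j ⟪g_i, g_j⟫` of
`KWeightTailOperator`; no operator on the physics side, no number, no row, nothing about a continuum limit or a mass gap.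

WHY.  In the operator-level kept-set tail theorem (`norm_le_of_galerkin_bound`, `le_norm_of_galerkin_witness`,
`KWeightTailOperatorBlock.norm_mem_Icc`, and the typed-tube assembly `KWeightTailTubeMain`) the kept family `f` must be
made of eigenvectors of the kinetic operator AND must span the kept isotypic components.  For the tube the spanning is
achieved by adjoining to the engine's spin networks (weights `q_ν > 0`) the ZERO MODES (`KWeightTailTubeZeroMode`:
weight `0`).  This file records that such a padding is free on the matrix side: the rows and columns of `G` indexed by
weight-zero members vanish, so

* `dotProduct_mulVec_galerkin_eq_truncate` — `cᵀ G c` only sees the coefficients on `{i | q_i ≠ 0}`;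
* **`galerkin_bound_of_support`** — a PSD test `cᵀ G c ≤ μ cᵀ c` (`μ ≥ 0`) checked on vectors supported on
  `{q ≠ 0}` holds for all `c`;
* **`galerkin_bound_of_sum`** — index type `α ⊕ γ` with `q = 0` on `γ`: the PSD test for the `α`-block `G'` (the
  engine's printed block) gives the PSD test for `G` with the same `μ`;
* **`galerkin_witness_of_sum`** — a Rayleigh witness `σ c'ᵀc' ≤ c'ᵀ G' c'` for the `α`-block, padded by zeros, is a
  witness for `G` (the input of `le_norm_of_galerkin_witness`);
* eigenvalue forms (the `hblock` input of `KWeightTailOperatorBlock.norm_mem_Icc_of_block` for the padded block):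
  `eigenvalues₀_zero_le_of_galerkin_bound` (`cᵀGc ≤ μ cᵀc ∀ c ⇒ λ↓₀(G) ≤ μ`), `le_eigenvalues₀_zero_of_witness`,
  **`block_eigenvalues₀_zero_le_padded`** (`λ↓₀(G') ≤ λ↓₀(G)`, Cauchy interlacing) and
  **`padded_eigenvalues₀_zero_le`** (`λ↓₀(G') ≤ hi`, `0 ≤ hi ⇒ λ↓₀(G) ≤ hi`), combined in
  **`padded_eigenvalues₀_zero_mem_Icc`**: a certified enclosure `lo ≤ λ↓₀(G') ≤ hi` (`hi ≥ 0`) of the printed block is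
  an enclosure of the padded block.

References: R. A. Horn, C. R. Johnson, *Matrix Analysis* (2013) §4.3 [cite: HornJohnson2013, §4.3].
-/

noncomputable section

open scoped InnerProductSpace BigOperators
open Matrix Finset

namespace Summit.Ventures.YMGap.FlowData

namespace KWeightTailOperator

section Pad

variable {F : Type*} [NormedAddCommGroup F] [InnerProductSpace ℝ F] {ι : Type*} [Fintype ι]
  {g : ι → F} {q : ι → ℝ} {G : Matrix ι ι ℝ}

omit [Fintype ι] in
/-- A row of the kept Galerkin block indexed by a weight-zero member vanishes. [folklore] -/
theorem galerkin_entry_eq_zero_of_left (hG : ∀ i j, G i j = √(q i) * √(q j) * ⟪g i, g j⟫_ℝ) {i : ι}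
    (hi : q i = 0) (j : ι) : G i j = 0 := by
  rw [hG, hi, Real.sqrt_zero, zero_mul, zero_mul]

omit [Fintype ι] in
/-- A column of the kept Galerkin block indexed by a weight-zero member vanishes. [folklore] -/
theorem galerkin_entry_eq_zero_of_right (hG : ∀ i j, G i j = √(q i) * √(q j) * ⟪g i, g j⟫_ℝ) {j : ι}
    (hj : q j = 0) (i : ι) : G i j = 0 := by
  rw [hG, hj, Real.sqrt_zero, mul_zero, zero_mul]

/-- **The Galerkin form only sees the coefficients on the support of the weights**:
`cᵀ G c = c̃ᵀ G c̃` with `c̃_i = c_i` if `q_i ≠ 0` and `0` otherwise. [cite: HornJohnson2013, §4.3] -/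
theorem dotProduct_mulVec_galerkin_eq_truncate (hG : ∀ i j, G i j = √(q i) * √(q j) * ⟪g i, g j⟫_ℝ)
    (c : ι → ℝ) :
    c ⬝ᵥ (G *ᵥ c) = (fun i => if q i = 0 then 0 else c i) ⬝ᵥ (G *ᵥ fun i => if q i = 0 then 0 else c i) := by
  simp only [dotProduct, mulVec]
  refine Finset.sum_congr rfl fun i _ => ?_
  by_cases hi : q i = 0
  · simp only [galerkin_entry_eq_zero_of_left hG hi, zero_mul, sum_const_zero, mul_zero]
  · simp only [hi, if_false]
    congr 1
    refine Finset.sum_congr rfl fun j _ => ?_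
    by_cases hj : q j = 0
    · simp only [galerkin_entry_eq_zero_of_right hG hj, zero_mul]
    · simp only [hj, if_false]

omit [Fintype ι] in
/-- Truncation does not increase the Euclidean norm: `c̃ᵀ c̃ ≤ cᵀ c`. [folklore] -/
theorem truncate_dotProduct_self_le [Fintype ι] (c : ι → ℝ) :
    (fun i => if q i = 0 then 0 else c i) ⬝ᵥ (fun i => if q i = 0 then 0 else c i) ≤ c ⬝ᵥ c := by
  simp only [dotProduct]
  refine Finset.sum_le_sum fun i _ => ?_
  split_ifs
  · simpa only [mul_zero] using mul_self_nonneg (c i)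
  · exact le_rfl

/-- **PADDING BY WEIGHT-ZERO MEMBERS COSTS NOTHING (PSD test).**  If the shifted PSD test `cᵀ G c ≤ μ cᵀ c` with
`μ ≥ 0` holds for every coefficient vector SUPPORTED ON `{i | q_i ≠ 0}`, it holds for every `c` — so in
`norm_le_of_galerkin_bound` the kept family may contain any number of weight-zero members (zero modes) without
changing the certificate. [cite: HornJohnson2013, §4.3] -/
theorem galerkin_bound_of_support (hG : ∀ i j, G i j = √(q i) * √(q j) * ⟪g i, g j⟫_ℝ) {μ : ℝ} (hμ0 : 0 ≤ μ)
    (hμ : ∀ c : ι → ℝ, (∀ i, q i = 0 → c i = 0) → c ⬝ᵥ (G *ᵥ c) ≤ μ * (c ⬝ᵥ c)) (c : ι → ℝ) :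
    c ⬝ᵥ (G *ᵥ c) ≤ μ * (c ⬝ᵥ c) := by
  rw [dotProduct_mulVec_galerkin_eq_truncate hG c]
  refine (hμ _ fun i hi => by simp only [hi, if_true]).trans ?_
  exact mul_le_mul_of_nonneg_left (truncate_dotProduct_self_le c) hμ0

end Pad

section Sum

variable {F : Type*} [NormedAddCommGroup F] [InnerProductSpace ℝ F] {α γ : Type*} [Fintype α] [Fintype γ]
  {g : α ⊕ γ → F} {q : α ⊕ γ → ℝ} {G : Matrix (α ⊕ γ) (α ⊕ γ) ℝ} {G' : Matrix α α ℝ}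

/-- For a coefficient vector vanishing on the `γ`-summand the Galerkin form of `G` is that of its `α`-block.
[folklore] -/
theorem dotProduct_mulVec_eq_inl (hG' : ∀ a a', G' a a' = G (Sum.inl a) (Sum.inl a')) {c : α ⊕ γ → ℝ}
    (hc : ∀ x, c (Sum.inr x) = 0) :
    c ⬝ᵥ (G *ᵥ c) = (fun a => c (Sum.inl a)) ⬝ᵥ (G' *ᵥ fun a => c (Sum.inl a)) := by
  simp only [dotProduct, mulVec, Fintype.sum_sum_type, hc, hG', zero_mul, mul_zero, add_zero, sum_const_zero]

omit [Fintype γ] in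
/-- For a coefficient vector vanishing on the `γ`-summand the Euclidean norm is that of its `α`-part. [folklore] -/
theorem dotProduct_self_eq_inl [Fintype γ] {c : α ⊕ γ → ℝ} (hc : ∀ x, c (Sum.inr x) = 0) :
    c ⬝ᵥ c = (fun a => c (Sum.inl a)) ⬝ᵥ fun a => c (Sum.inl a) := by
  simp only [dotProduct, Fintype.sum_sum_type, hc, mul_zero, sum_const_zero, add_zero]

/-- **PADDING BY WEIGHT-ZERO MEMBERS COSTS NOTHING (block form).**  Index type `α ⊕ γ` with all weights on `γ`
equal to `0` (zero modes) and `G'` the `α`-block of the kept Galerkin block (the engine's printed block): the PSD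
test `c'ᵀ G' c' ≤ μ c'ᵀ c'` (`μ ≥ 0`) for `G'` gives the PSD test for `G` with the same `μ` — the hypothesis `hμ` of
`norm_le_of_galerkin_bound`. [cite: HornJohnson2013, §4.3] -/
theorem galerkin_bound_of_sum (hG : ∀ i j, G i j = √(q i) * √(q j) * ⟪g i, g j⟫_ℝ)
    (hq : ∀ x : γ, q (Sum.inr x) = 0) (hG' : ∀ a a', G' a a' = G (Sum.inl a) (Sum.inl a')) {μ : ℝ}
    (hμ0 : 0 ≤ μ) (hμ' : ∀ c' : α → ℝ, c' ⬝ᵥ (G' *ᵥ c') ≤ μ * (c' ⬝ᵥ c')) (c : α ⊕ γ → ℝ) :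
    c ⬝ᵥ (G *ᵥ c) ≤ μ * (c ⬝ᵥ c) := by
  refine galerkin_bound_of_support hG hμ0 (fun c hc => ?_) c
  have hcr : ∀ x, c (Sum.inr x) = 0 := fun x => hc _ (hq x)
  rw [dotProduct_mulVec_eq_inl hG' hcr, dotProduct_self_eq_inl hcr]
  exact hμ' _

omit [Fintype γ] in
/-- **A Rayleigh witness of the `α`-block, padded by zeros, is a Rayleigh witness of `G`** — the hypotheses `hc`, `hσ`
of `le_norm_of_galerkin_witness` for the padded vector `Sum.elim c' 0`. [cite: HornJohnson2013, §4.3] -/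
theorem galerkin_witness_of_sum [Fintype γ] (hG' : ∀ a a', G' a a' = G (Sum.inl a) (Sum.inl a')) {σ : ℝ}
    {c' : α → ℝ} (hc' : 0 < c' ⬝ᵥ c') (hσ' : σ * (c' ⬝ᵥ c') ≤ c' ⬝ᵥ (G' *ᵥ c')) :
    0 < Sum.elim c' (0 : γ → ℝ) ⬝ᵥ Sum.elim c' (0 : γ → ℝ) ∧
      σ * (Sum.elim c' (0 : γ → ℝ) ⬝ᵥ Sum.elim c' (0 : γ → ℝ)) ≤
        Sum.elim c' (0 : γ → ℝ) ⬝ᵥ (G *ᵥ Sum.elim c' (0 : γ → ℝ)) := by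
  have hcr : ∀ x, (Sum.elim c' (0 : γ → ℝ)) (Sum.inr x) = 0 := fun x => rfl
  rw [dotProduct_mulVec_eq_inl hG' hcr, dotProduct_self_eq_inl hcr]
  exact ⟨hc', hσ'⟩

end Sum

/-! ### Eigenvalue forms (interface `Matrix.IsHermitian.eigenvalues₀`, as in `KWeightTailOperatorBlock`) -/

section Eigen

variable {ι : Type*} [Fintype ι] [DecidableEq ι] {G : Matrix ι ι ℝ}

/-- `λ↓₀(G) ≤ μ` as soon as `cᵀ G c ≤ μ cᵀ c` for every `c` (Rayleigh: `λ↓₀ = hᵀ G h` at a unit top eigenvector).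
[cite: HornJohnson2013, Thm 4.2.2] -/
theorem eigenvalues₀_zero_le_of_galerkin_bound (hGh : G.IsHermitian) (h0 : 0 < Fintype.card ι) {μ : ℝ}
    (hμ : ∀ c : ι → ℝ, c ⬝ᵥ (G *ᵥ c) ≤ μ * (c ⬝ᵥ c)) : hGh.eigenvalues₀ ⟨0, h0⟩ ≤ μ := by
  have h1 : 1 ≤ Fintype.card ι := h0
  obtain ⟨h, horth, -, hsum⟩ := Literature.Analysis.Matrix.KyFan.exists_frame_sum_rayleigh_eq hGh h1
  have hh : h 0 ⬝ᵥ h 0 = 1 := by simpa using horth 0 0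
  have hq : h 0 ⬝ᵥ (G *ᵥ h 0) = hGh.eigenvalues₀ (Fin.castLE h1 0) := by
    simpa only [Finset.univ_unique, Fin.default_eq_zero, Finset.sum_singleton] using hsum
  have hidx : (⟨0, h0⟩ : Fin (Fintype.card ι)) = Fin.castLE h1 0 := Fin.ext rfl
  rw [hidx, ← hq]
  simpa only [hh, mul_one] using hμ (h 0)

/-- `σ ≤ λ↓₀(G)` from a Rayleigh witness `σ cᵀc ≤ cᵀ G c`, `cᵀc > 0`. [cite: HornJohnson2013, Thm 4.2.2] -/
theorem le_eigenvalues₀_zero_of_witness (hGh : G.IsHermitian) (h0 : 0 < Fintype.card ι) {σ : ℝ} {c : ι → ℝ}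
    (hc : 0 < c ⬝ᵥ c) (hσ : σ * (c ⬝ᵥ c) ≤ c ⬝ᵥ (G *ᵥ c)) : σ ≤ hGh.eigenvalues₀ ⟨0, h0⟩ := by
  have h1 : 1 ≤ Fintype.card ι := h0
  have hidx : (⟨0, h0⟩ : Fin (Fintype.card ι)) = Fin.castLE h1 0 := Fin.ext rfl
  have h := Literature.Analysis.Matrix.KyFan.dotProduct_mulVec_le_eigenvalues₀_max_mul hGh h1 c
  rw [hidx]
  exact le_of_mul_le_mul_right (hσ.trans h) hc

variable {F : Type*} [NormedAddCommGroup F] [InnerProductSpace ℝ F] {α γ : Type*} [Fintype α] [Fintype γ]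
  [DecidableEq α] [DecidableEq γ] {g : α ⊕ γ → F} {q : α ⊕ γ → ℝ} {Gs : Matrix (α ⊕ γ) (α ⊕ γ) ℝ}
  {G' : Matrix α α ℝ}

omit [Fintype α] [Fintype γ] [DecidableEq α] [DecidableEq γ] in
/-- The `α`-block as a principal submatrix. [folklore] -/
theorem submatrix_inl_eq (hG' : ∀ a a', G' a a' = Gs (Sum.inl a) (Sum.inl a')) :
    Gs.submatrix Sum.inl Sum.inl = G' := by
  ext a a'
  rw [submatrix_apply, hG']

/-- **Cauchy interlacing for the padding**: the top eigenvalue of the `α`-block is at most the top eigenvalue of the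
padded block, `λ↓₀(G') ≤ λ↓₀(G)` (no hypothesis on the weights). [cite: HornJohnson2013, Thm 4.3.28] -/
theorem block_eigenvalues₀_zero_le_padded (hGsh : Gs.IsHermitian) (hG'h : G'.IsHermitian)
    (hG' : ∀ a a', G' a a' = Gs (Sum.inl a) (Sum.inl a')) (hα : 0 < Fintype.card α)
    (h0 : 0 < Fintype.card (α ⊕ γ)) : hG'h.eigenvalues₀ ⟨0, hα⟩ ≤ hGsh.eigenvalues₀ ⟨0, h0⟩ := by
  have hGG := submatrix_inl_eq hG'
  subst hGG
  have h := Literature.Analysis.Matrix.KyFan.eigenvalues₀_submatrix_le hGsh ⟨Sum.inl, Sum.inl_injective⟩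
    hG'h ⟨0, hα⟩
  exact h.trans (le_of_eq (congrArg hGsh.eigenvalues₀ (Fin.ext rfl)))

/-- **Upper half for the padding**: weights `0` on `γ`, `Gs` the kept Galerkin block on `α ⊕ γ`, `G'` its `α`-block;
then `λ↓₀(G') ≤ hi` with `hi ≥ 0` gives `λ↓₀(Gs) ≤ hi`. [cite: HornJohnson2013, §4.3] -/
theorem padded_eigenvalues₀_zero_le (hGs : ∀ i j, Gs i j = √(q i) * √(q j) * ⟪g i, g j⟫_ℝ)
    (hq : ∀ x : γ, q (Sum.inr x) = 0) (hGsh : Gs.IsHermitian) (hG'h : G'.IsHermitian)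
    (hG' : ∀ a a', G' a a' = Gs (Sum.inl a) (Sum.inl a')) (hα : 0 < Fintype.card α)
    (h0 : 0 < Fintype.card (α ⊕ γ)) {hi : ℝ} (hhi0 : 0 ≤ hi) (hhi : hG'h.eigenvalues₀ ⟨0, hα⟩ ≤ hi) :
    hGsh.eigenvalues₀ ⟨0, h0⟩ ≤ hi := by
  have h1 : 1 ≤ Fintype.card α := hα
  have hidx : (⟨0, hα⟩ : Fin (Fintype.card α)) = Fin.castLE h1 0 := Fin.ext rfl
  refine eigenvalues₀_zero_le_of_galerkin_bound hGsh h0 (galerkin_bound_of_sum hGs hq hG' hhi0 fun c' => ?_)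
  have hcc : 0 ≤ c' ⬝ᵥ c' := by
    rw [dotProduct]; exact Finset.sum_nonneg fun i _ => mul_self_nonneg _
  have h := Literature.Analysis.Matrix.KyFan.dotProduct_mulVec_le_eigenvalues₀_max_mul hG'h h1 c'
  rw [← hidx] at h
  exact h.trans (mul_le_mul_of_nonneg_right hhi hcc)

/-- **PADDING BY WEIGHT-ZERO MEMBERS COSTS NOTHING (eigenvalue form).**  A certified enclosure
`lo ≤ λ↓₀(G') ≤ hi` (`hi ≥ 0`) of the engine's printed block `G'` is an enclosure of the top eigenvalue of the kept
Galerkin block `Gs` padded by zero modes — the hypothesis `hblock` of `KWeightTailOperatorBlock.norm_mem_Icc_of_block`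
for the padded kept family. [cite: HornJohnson2013, §4.3] -/
theorem padded_eigenvalues₀_zero_mem_Icc (hGs : ∀ i j, Gs i j = √(q i) * √(q j) * ⟪g i, g j⟫_ℝ)
    (hq : ∀ x : γ, q (Sum.inr x) = 0) (hGsh : Gs.IsHermitian) (hG'h : G'.IsHermitian)
    (hG' : ∀ a a', G' a a' = Gs (Sum.inl a) (Sum.inl a')) (hα : 0 < Fintype.card α)
    (h0 : 0 < Fintype.card (α ⊕ γ)) {lo hi : ℝ} (hhi0 : 0 ≤ hi)
    (hblock : lo ≤ hG'h.eigenvalues₀ ⟨0, hα⟩ ∧ hG'h.eigenvalues₀ ⟨0, hα⟩ ≤ hi) :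
    lo ≤ hGsh.eigenvalues₀ ⟨0, h0⟩ ∧ hGsh.eigenvalues₀ ⟨0, h0⟩ ≤ hi :=
  ⟨hblock.1.trans (block_eigenvalues₀_zero_le_padded hGsh hG'h hG' hα h0),
    padded_eigenvalues₀_zero_le hGs hq hGsh hG'h hG' hα h0 hhi0 hblock.2⟩

end Eigen

end KWeightTailOperator

end Summit.Ventures.YMGap.FlowData
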